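import Summits.Ventures.PercRepro.MSSplitMono

/-!
# Step 5 of Theorem 10.1: a split with one side a single member has two members covering

proofs/P4-gen9.md §10, Step 5. Let `F = {X} ⊔ Q` be split, with a down-closed difference family
containing every singleton of the support `u`, no member a difference, Marica–Schönheim excess one;
assume every coordinate of `X` misses some member of `Q` and every coordinate outside `X` lies in
some and misses some member of `Q`. Then two members of `F` cover `u` (`cover_of_single_side`).

Proof (by contradiction: no two members cover). For `r′ ∉ X` the addable class `M′` of the
projection along `r′` has no `0`-lift and lies on `Q`'s side (`forall_mem_of_zero_lift` would put
`r′` in `X` or in every member of `Q`), so `X ∪ M′ ∈ F′` forces `M′ ⊆ X`; hence every coordinate of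
`u ∖ X` other than `r′` is deletable and deleting `b ∖ X` from a member `b ∈ Q` leaves `b ∩ X ∈ F′`,
whose only possible lift is `insert r′ (b ∩ X) ∈ Q` (`trace_insert_mem`). Then for members `b, b′`
with the same part `β` outside `X` and `r′ ∉ X ∪ β` (no cover!), `b \ (insert r′ (b′ ∩ X)) =
((b ∩ X) \ (b′ ∩ X)) ∪ β` is good: the families `D(𝒜_β) ∪ β` (β the parts outside `X`) are disjoint
good families of total size ≥ |Q| (Marica–Schönheim per class), disjoint from the good family
`D(𝒜 ∪ {X}) ⊆ 2^X` of size ≥ |𝒜| + 1 ≥ 3. So |G| ≥ |Q| + 3 = |F| + 2, against excess one.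
-/

namespace PercRepro.MSTight

open Finset
open scoped FinsetFamily

variable {α : Type*} [DecidableEq α]

section Single

variable {u : Finset α} {F Q : Finset (Finset α)} {X : Finset α}

/-- STEP 5a: for `r′ ∉ X`, the `X`-trace of every member of `Q`, with `r′` added, is a member. -/
theorem trace_insert_mem (hFu : ∀ A ∈ F, A ⊆ u) (hsp : IsSplit F {X} Q) (hD : IsDownSet (F \\ F))
    (hexc : (F \\ F).card = F.card + 1) {r' : α} (hr' : ({r'} : Finset α) ∈ F \\ F)
    (hr'X : r' ∉ X) (hsome : ∃ b ∈ Q, r' ∉ b) {b : Finset α} (hb : b ∈ Q) :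
    insert r' (b ∩ X) ∈ Q := by
  obtain ⟨hproj, hD', hF'u, hF'ne⟩ := proj_facts u hFu hsp hD hexc hr'
  have hMmem : addableSet (u.erase r') (proj r' F) ∈ proj r' F :=
    addableSet_mem hproj hD' hF'u hF'ne
  have hXF : X ∈ F := by
    rw [← hsp.union]; exact Finset.mem_union_left Q (Finset.mem_singleton_self X)
  have hbF : b ∈ F := by rw [← hsp.union]; exact Finset.mem_union_right _ hb
  have hmemF : ∀ {A : Finset α}, A ∈ F → A = X ∨ A ∈ Q := by
    intro A hA
    rw [← hsp.union] at hA
    rcases Finset.mem_union.1 hA with h | h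
    · exact Or.inl (Finset.mem_singleton.1 h)
    · exact Or.inr h
  -- `M` lies on `Q`'s side and has no `0`-lift
  have hMQ : OnSide Q r' (addableSet (u.erase r') (proj r' F)) := by
    rcases onSide_or_onSide hsp.union (lift_of_mem_proj hMmem).2 with h | h
    · exfalso
      rcases h with h | h
      · -- `M = X`, a `0`-lift on side `{X}`: every member of `Q` would contain `r′`
        rw [Finset.mem_singleton] at h
        obtain ⟨b₀, hb₀, hb₀r⟩ := hsome
        have hside : OnSide {X} r' (addableSet (u.erase r') (proj r' F)) :=
          Or.inl (by rw [h]; exact Finset.mem_singleton_self X)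
        have h0 : addableSet (u.erase r') (proj r' F) ∈ F := by rw [h]; exact hXF
        exact hb₀r (forall_mem_of_zero_lift u hFu hsp hD hexc hr' hside h0 b₀ hb₀)
      · rw [Finset.mem_singleton] at h
        exact hr'X (h ▸ Finset.mem_insert_self r' _)
    · exact h
  have hM0 : addableSet (u.erase r') (proj r' F) ∉ F := by
    intro h0
    exact hr'X (forall_mem_of_zero_lift u hFu hsp.symm hD hexc hr' hMQ h0 X
      (Finset.mem_singleton_self X))
  -- `M ⊆ X`: a lift of `X ∪ M` would contain `X`
  have hXF' : X ∈ proj r' F := mem_proj.2 ⟨X, hXF, Finset.erase_eq_of_notMem hr'X⟩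
  have hMX : addableSet (u.erase r') (proj r' F) ⊆ X := by
    have hu := union_addableSet_mem (u := u.erase r') hXF'
    rcases (lift_of_mem_proj hu).2 with h | h
    · rcases hmemF h with h | h
      · intro x hx
        have : x ∈ X ∪ addableSet (u.erase r') (proj r' F) := Finset.mem_union_right X hx
        rw [h] at this; exact this
      · exact absurd Finset.subset_union_left (hsp.cross X (Finset.mem_singleton_self X) _ h).1
    · rcases hmemF h with h | h
      · exact absurd (h ▸ Finset.mem_insert_self r' _) hr'X
      · exact absurd (Finset.subset_union_left.trans (Finset.subset_insert r' _))
          (hsp.cross X (Finset.mem_singleton_self X) _ h).1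
  -- delete the coordinates of `b` outside `X` (all deletable): `b ∩ X ∈ F′`
  have hμ : b.erase r' ∈ proj r' F := mem_proj.2 ⟨b, hbF, rfl⟩
  have hdel : ∀ c ∈ (b \ X).erase r', Deletable (proj r' F) c := by
    intro c hc
    have hc1 : c ∈ u.erase r' := by
      rw [Finset.mem_erase] at hc ⊢
      exact ⟨hc.1, hFu b hbF (Finset.mem_sdiff.1 hc.2).1⟩
    have hc2 : c ∉ addableSet (u.erase r') (proj r' F) :=
      fun h => (Finset.mem_sdiff.1 (Finset.mem_erase.1 hc).2).2 (hMX h)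
    exact deletable_of_notMem_addableSet hproj hD' hc1 hc2
  have htr : b.erase r' \ (b \ X).erase r' = b ∩ X := by
    ext x
    constructor
    · intro hx
      obtain ⟨hx1, hx2⟩ := Finset.mem_sdiff.1 hx
      obtain ⟨hxr, hxb⟩ := Finset.mem_erase.1 hx1
      refine Finset.mem_inter.2 ⟨hxb, ?_⟩
      by_contra hxX
      exact hx2 (Finset.mem_erase.2 ⟨hxr, Finset.mem_sdiff.2 ⟨hxb, hxX⟩⟩)
    · intro hx
      obtain ⟨hxb, hxX⟩ := Finset.mem_inter.1 hx
      refine Finset.mem_sdiff.2 ⟨Finset.mem_erase.2 ⟨fun h => hr'X (h ▸ hxX), hxb⟩, ?_⟩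
      intro h
      exact (Finset.mem_sdiff.1 (Finset.mem_erase.1 h).2).2 hxX
  have htrF' : b ∩ X ∈ proj r' F := by
    rw [← htr]; exact sdiff_mem_of_deletable hμ _ hdel
  -- its lift is `insert r′ (b ∩ X)`, which lies in `Q`
  rcases (lift_of_mem_proj htrF').2 with h | h
  · exfalso
    rcases hmemF h with h | h
    · exact (hsp.cross X (Finset.mem_singleton_self X) b hb).1
        (by rw [← h]; exact Finset.inter_subset_left)
    · exact (hsp.cross X (Finset.mem_singleton_self X) _ h).2 Finset.inter_subset_right
  · rcases hmemF h with h | h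
    · exact absurd (h ▸ Finset.mem_insert_self r' _) hr'X
    · exact h


/-- The pure good family `D(𝒜 ∪ {X})` of the traces on `X` (as subsets of `X`). -/
theorem diffs_traces_subset_filter (hsp : IsSplit F {X} Q) (hD : IsDownSet (F \\ F)) :
    (insert X (Q.image fun b => b ∩ X)) \\ (insert X (Q.image fun b => b ∩ X)) ⊆
      (F \\ F).filter fun W => W ⊆ X := by
  have hXF : X ∈ F := by
    rw [← hsp.union]; exact Finset.mem_union_left Q (Finset.mem_singleton_self X)
  have hQF : ∀ b ∈ Q, b ∈ F := fun b hb => by rw [← hsp.union]; exact Finset.mem_union_right _ hb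
  have hsubX : ∀ c ∈ insert X (Q.image fun b => b ∩ X), c ⊆ X := by
    intro c hc
    rcases Finset.mem_insert.1 hc with h | hc
    · rw [h]
    · obtain ⟨b, -, rfl⟩ := Finset.mem_image.1 hc
      exact Finset.inter_subset_right
  -- every difference of two traces (or `X`) is a difference of two members, up to a subset
  have key : ∀ a ∈ insert X (Q.image fun b => b ∩ X), ∀ a' ∈ insert X (Q.image fun b => b ∩ X),
      a \ a' ∈ F \\ F := by
    intro a ha a' ha'
    have hmemF : ∀ c ∈ insert X (Q.image fun b => b ∩ X), ∃ B ∈ F, c = B ∩ X := by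
      intro c hc
      rcases Finset.mem_insert.1 hc with h | hc
      · exact ⟨X, hXF, by rw [h, Finset.inter_self]⟩
      · obtain ⟨b, hb, rfl⟩ := Finset.mem_image.1 hc
        exact ⟨b, hQF b hb, rfl⟩
    obtain ⟨B, hB, rfl⟩ := hmemF a ha
    obtain ⟨B', hB', rfl⟩ := hmemF a' ha'
    have hmem : B \ B' ∈ F \\ F := Finset.mem_diffs.2 ⟨B, hB, B', hB', rfl⟩
    refine hD _ hmem _ ?_
    intro x hx
    obtain ⟨hx1, hx2⟩ := Finset.mem_sdiff.1 hx
    exact Finset.mem_sdiff.2 ⟨(Finset.mem_inter.1 hx1).1,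
      fun h => hx2 (Finset.mem_inter.2 ⟨h, (Finset.mem_inter.1 hx1).2⟩)⟩
  intro W hW
  obtain ⟨a, ha, a', ha', rfl⟩ := Finset.mem_diffs.1 hW
  exact Finset.mem_filter.2 ⟨key a ha a' ha', Finset.sdiff_subset.trans (hsubX a ha)⟩

/-- The difference of a member and the lifted trace of another member with the same part outside
`X`: `b \ insert r' (b' ∩ X) = ((b ∩ X) \ (b' ∩ X)) ∪ (b \ X)` when `r' ∉ X ∪ b`. -/
theorem sdiff_insert_trace_eq {b b' : Finset α} {r' : α} (hr'X : r' ∉ X) (hr'b : r' ∉ b) :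
    b \ insert r' (b' ∩ X) = ((b ∩ X) \ (b' ∩ X)) ∪ (b \ X) := by
  ext x
  constructor
  · intro hx
    obtain ⟨hxb, hx2⟩ := Finset.mem_sdiff.1 hx
    have hxr : x ≠ r' := fun h => hx2 (Finset.mem_insert.2 (Or.inl h))
    have hx3 : x ∉ b' ∩ X := fun h => hx2 (Finset.mem_insert_of_mem h)
    by_cases hxX : x ∈ X
    · exact Finset.mem_union_left _ (Finset.mem_sdiff.2 ⟨Finset.mem_inter.2 ⟨hxb, hxX⟩, hx3⟩)
    · exact Finset.mem_union_right _ (Finset.mem_sdiff.2 ⟨hxb, hxX⟩)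
  · intro hx
    rcases Finset.mem_union.1 hx with hx | hx
    · obtain ⟨hx1, hx3⟩ := Finset.mem_sdiff.1 hx
      obtain ⟨hxb, hxX⟩ := Finset.mem_inter.1 hx1
      refine Finset.mem_sdiff.2 ⟨hxb, ?_⟩
      intro h
      rcases Finset.mem_insert.1 h with h | h
      · exact hr'X (h ▸ hxX)
      · exact hx3 h
    · obtain ⟨hxb, hxX⟩ := Finset.mem_sdiff.1 hx
      refine Finset.mem_sdiff.2 ⟨hxb, ?_⟩
      intro h
      rcases Finset.mem_insert.1 h with h | h
      · exact hr'b (h ▸ hxb)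
      · exact hxX (Finset.mem_inter.1 h).2


open Classical in
/-- **STEP 5 (the residual case).** If one side of the split is the single member `X`, every
coordinate of `X` misses some member of `Q`, every coordinate outside `X` misses some member of
`Q`, and the standing hypotheses hold, then two members of `F` cover `u`. -/
theorem cover_of_single_side (hFu : ∀ A ∈ F, A ⊆ u) (hsp : IsSplit F {X} Q)
    (hD : IsDownSet (F \\ F)) (hsing : ∀ r ∈ u, ({r} : Finset α) ∈ F \\ F)
    (hFG : ∀ A ∈ F, A ∉ F \\ F) (hexc : (F \\ F).card = F.card + 1)
    (hX : ∀ r ∈ X, ∃ b ∈ Q, r ∉ b) (hXc : ∀ r ∈ u, r ∉ X → ∃ b ∈ Q, r ∉ b) :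
    ∃ a ∈ F, ∃ b ∈ F, a ∪ b = u := by
  by_contra hnc
  push Not at hnc
  have hXF : X ∈ F := by
    rw [← hsp.union]; exact Finset.mem_union_left Q (Finset.mem_singleton_self X)
  have hQF : ∀ b ∈ Q, b ∈ F := fun b hb => by rw [← hsp.union]; exact Finset.mem_union_right _ hb
  have hcross : ∀ b ∈ Q, ¬ X ⊆ b ∧ ¬ b ⊆ X := fun b hb => hsp.cross X (Finset.mem_singleton_self X) b hb
  -- (i) for every `b ∈ Q` a coordinate outside `X ∪ b`
  have hout : ∀ b ∈ Q, ∃ r' ∈ u, r' ∉ X ∧ r' ∉ b := by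
    intro b hb
    by_contra h
    push Not at h
    apply hnc X hXF b (hQF b hb)
    apply Finset.Subset.antisymm (Finset.union_subset (hFu X hXF) (hFu b (hQF b hb)))
    intro x hx
    by_cases hxX : x ∈ X
    · exact Finset.mem_union_left _ hxX
    · exact Finset.mem_union_right _ (h x hx hxX)
  -- (ii) the pure part: `|D(𝒜 ∪ {X})| ≥ |𝒜| + 1 ≥ 3`
  have hXnot : X ∉ Q.image fun b => b ∩ X := by
    intro h
    obtain ⟨b, hb, hbX⟩ := Finset.mem_image.1 h
    exact (hcross b hb).1 (by rw [← hbX]; exact Finset.inter_subset_left)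
  have htrace_ne : ∀ b ∈ Q, (b ∩ X).Nonempty := by
    intro b hb
    rw [Finset.nonempty_iff_ne_empty]
    intro h
    -- then `b = b \ X` is a difference
    apply hFG b (hQF b hb)
    have : b \ X = b := by
      ext x; simp only [Finset.mem_sdiff]
      constructor
      · exact fun hx => hx.1
      · intro hx; refine ⟨hx, fun hxX => ?_⟩
        have : x ∈ b ∩ X := Finset.mem_inter.2 ⟨hx, hxX⟩
        rw [h] at this; exact Finset.notMem_empty x this
    rw [← this]
    exact Finset.mem_diffs.2 ⟨b, hQF b hb, X, hXF, rfl⟩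
  have h𝒜2 : 2 ≤ (Q.image fun b => b ∩ X).card := by
    obtain ⟨b₀, hb₀⟩ := hsp.ne_t
    obtain ⟨r, hr⟩ := htrace_ne b₀ hb₀
    obtain ⟨b₁, hb₁, hrb₁⟩ := hX r (Finset.mem_inter.1 hr).2
    have hne : b₀ ∩ X ≠ b₁ ∩ X := by
      intro h
      rw [h] at hr
      exact hrb₁ (Finset.mem_inter.1 hr).1
    have : ({b₀ ∩ X, b₁ ∩ X} : Finset (Finset α)) ⊆ Q.image fun b => b ∩ X := by
      intro c hc
      rcases Finset.mem_insert.1 hc with rfl | hc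
      · exact Finset.mem_image.2 ⟨b₀, hb₀, rfl⟩
      · rw [Finset.mem_singleton] at hc
        rw [hc]; exact Finset.mem_image.2 ⟨b₁, hb₁, rfl⟩
    have := Finset.card_le_card this
    rwa [Finset.card_pair hne] at this
  have hpure : (Q.image fun b => b ∩ X).card + 1 ≤ ((F \\ F).filter fun W => W ⊆ X).card := by
    calc (Q.image fun b => b ∩ X).card + 1
        = (insert X (Q.image fun b => b ∩ X)).card := (Finset.card_insert_of_notMem hXnot).symm
      _ ≤ ((insert X (Q.image fun b => b ∩ X)) \\ (insert X (Q.image fun b => b ∩ X))).card :=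
          Finset.card_le_card_diffs _
      _ ≤ _ := Finset.card_le_card (diffs_traces_subset_filter hsp hD)
  -- (iii) the mixed part: for each part `β` outside `X`, the good family `D(𝒜_β) ∪ β`
  set ℬ : Finset (Finset α) := Q.image fun b => b \ X with hℬ
  let Qf : Finset α → Finset (Finset α) := fun β => Q.filter fun b => b \ X = β
  let 𝒜f : Finset α → Finset (Finset α) := fun β => (Qf β).image fun b => b ∩ X
  let 𝒢 : Finset α → Finset (Finset α) := fun β => ((𝒜f β) \\ (𝒜f β)).image fun d => d ∪ β
  have hβX : ∀ β ∈ ℬ, Disjoint β X := by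
    intro β hβ
    obtain ⟨b, -, rfl⟩ := Finset.mem_image.1 hβ
    exact Finset.sdiff_disjoint
  have hβne : ∀ β ∈ ℬ, β.Nonempty := by
    intro β hβ
    obtain ⟨b, hb, rfl⟩ := Finset.mem_image.1 hβ
    rw [Finset.nonempty_iff_ne_empty]
    intro h
    exact (hcross b hb).2 (Finset.sdiff_eq_empty_iff_subset.1 h)
  have h𝒜f_sub : ∀ β, ∀ d ∈ 𝒜f β \\ 𝒜f β, d ⊆ X := by
    intro β d hd
    obtain ⟨a, ha, a', -, rfl⟩ := Finset.mem_diffs.1 hd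
    obtain ⟨b, -, rfl⟩ := Finset.mem_image.1 ha
    exact Finset.sdiff_subset.trans Finset.inter_subset_right
  -- `𝒢 β` consists of good sets not inside `X`
  have h𝒢sub : ∀ β ∈ ℬ, 𝒢 β ⊆ (F \\ F).filter fun W => ¬ W ⊆ X := by
    intro β hβ W hW
    obtain ⟨d, hd, rfl⟩ := Finset.mem_image.1 hW
    obtain ⟨a, ha, a', ha', rfl⟩ := Finset.mem_diffs.1 hd
    obtain ⟨b, hb, rfl⟩ := Finset.mem_image.1 ha
    obtain ⟨b', hb', rfl⟩ := Finset.mem_image.1 ha'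
    rw [Finset.mem_filter] at hb hb'
    obtain ⟨r', hr'u, hr'X, hr'b⟩ := hout b hb.1
    have hins : insert r' (b' ∩ X) ∈ Q :=
      trace_insert_mem hFu hsp hD hexc (hsing r' hr'u) hr'X (hXc r' hr'u hr'X) hb'.1
    refine Finset.mem_filter.2 ⟨?_, ?_⟩
    · rw [← hb.2, ← sdiff_insert_trace_eq hr'X hr'b]
      exact Finset.mem_diffs.2 ⟨b, hQF b hb.1, _, hQF _ hins, rfl⟩
    · intro hsub
      obtain ⟨x, hx⟩ := hβne β hβ
      have hxX : x ∈ X := hsub (Finset.mem_union_right _ hx)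
      exact Finset.disjoint_left.1 (hβX β hβ) hx hxX
  -- `|𝒢 β| ≥ |Q_β|`
  have h𝒢card : ∀ β ∈ ℬ, (Qf β).card ≤ (𝒢 β).card := by
    intro β hβ
    have h1 : (Qf β).card = (𝒜f β).card := by
      symm
      apply Finset.card_image_of_injOn
      intro b hb b' hb' h
      have hb2 : b \ X = β := (Finset.mem_filter.1 (Finset.mem_coe.1 hb)).2
      have hb'2 : b' \ X = β := (Finset.mem_filter.1 (Finset.mem_coe.1 hb')).2
      have e1 : b = (b ∩ X) ∪ (b \ X) := by
        ext x; simp only [Finset.mem_union, Finset.mem_inter, Finset.mem_sdiff]; tauto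
      have e2 : b' = (b' ∩ X) ∪ (b' \ X) := by
        ext x; simp only [Finset.mem_union, Finset.mem_inter, Finset.mem_sdiff]; tauto
      have h' : b ∩ X = b' ∩ X := h
      rw [e1, e2, hb2, hb'2, h']
    have h2 : (𝒜f β).card ≤ (𝒜f β \\ 𝒜f β).card := Finset.card_le_card_diffs _
    have h3 : (𝒜f β \\ 𝒜f β).card = (𝒢 β).card := by
      symm
      apply Finset.card_image_of_injOn
      intro d hd d' hd' h
      have hdX : d ⊆ X := h𝒜f_sub β d (Finset.mem_coe.1 hd)
      have hd'X : d' ⊆ X := h𝒜f_sub β d' (Finset.mem_coe.1 hd')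
      have hdisj := hβX β hβ
      have e : ∀ e ⊆ X, (e ∪ β) ∩ X = e := by
        intro e he
        ext x
        simp only [Finset.mem_inter, Finset.mem_union]
        constructor
        · rintro ⟨hx | hx, hxX⟩
          · exact hx
          · exact absurd hxX (Finset.disjoint_left.1 hdisj hx)
        · intro hx; exact ⟨Or.inl hx, he hx⟩
      have h' : d ∪ β = d' ∪ β := h
      rw [← e d hdX, ← e d' hd'X, h']
    omega
  -- the `𝒢 β` are pairwise disjoint: the part outside `X` of a member of `𝒢 β` is `β`
  have h𝒢part : ∀ β ∈ ℬ, ∀ W ∈ 𝒢 β, W \ X = β := by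
    intro β hβ W hW
    obtain ⟨d, hd, rfl⟩ := Finset.mem_image.1 hW
    have hdX : d ⊆ X := h𝒜f_sub β d hd
    have hdisj := hβX β hβ
    ext x
    simp only [Finset.mem_sdiff, Finset.mem_union]
    constructor
    · rintro ⟨hx | hx, hxX⟩
      · exact absurd (hdX hx) hxX
      · exact hx
    · intro hx
      exact ⟨Or.inr hx, Finset.disjoint_left.1 hdisj hx⟩
  have hdisjoint : ∀ β ∈ ℬ, ∀ β' ∈ ℬ, β ≠ β' → Disjoint (𝒢 β) (𝒢 β') := by
    intro β hβ β' hβ' hne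
    rw [Finset.disjoint_left]
    intro W hW hW'
    exact hne ((h𝒢part β hβ W hW).symm.trans (h𝒢part β' hβ' W hW'))
  have hmix : Q.card ≤ ((F \\ F).filter fun W => ¬ W ⊆ X).card := by
    calc Q.card = ∑ β ∈ ℬ, (Qf β).card :=
          Finset.card_eq_sum_card_fiberwise (fun b hb => Finset.mem_image.2 ⟨b, hb, rfl⟩)
      _ ≤ ∑ β ∈ ℬ, (𝒢 β).card := Finset.sum_le_sum h𝒢card
      _ = (ℬ.biUnion 𝒢).card := (Finset.card_biUnion hdisjoint).symm
      _ ≤ _ := Finset.card_le_card (Finset.biUnion_subset.2 h𝒢sub)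
  -- (iv) the count
  have hsplitcard := Finset.card_filter_add_card_filter_not (s := F \\ F) (fun W : Finset α => W ⊆ X)
  have hFcard : F.card = Q.card + 1 := by
    rw [← hsp.union, Finset.card_union_of_disjoint hsp.disj, Finset.card_singleton]; ring
  omega

end Single

end PercRepro.MSTight
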